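import Literature.Computation.Certificates.GramSOS
import Summits.Ventures.GridStability.Models.ClassicalSwing

/-!
# Polynomial recast of the classical multimachine swing model (deviation convention, PARTITION A1)

Venture GRIDFUSION (rungs G3 → G1.WSCC9 / G1.a′), cell `run/shared/lean/pub/gridfusion/`, seat model-1.
Printed recast: Kundu–Anghel, ECC 2015 (arXiv:1503.07541) §6.2 — relative angles to a reference
machine, `sin` / `1 − cos` of the shifted relative angle as new variables, speeds unchanged, constraints
`σ² + κ² − 2κ = 0`, equilibrium at `0` [corpus:paper:arxiv-1503.07541 p.10] (= Anghel–Milano–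
Papachristodoulou, IEEE TCAS-I 60 (2013)). The model being recast is `ClassicalSwing`
(Anderson–Fouad §2.9 (2.55)–(2.57) = Sauer–Pai (7.212)–(7.216) + (5.157)); locators there.

CONVENTIONS (binding; INBOX model-1 2026-08-26): `n + 1` machines `Fin (n+1)`, machine `0` = the
REFERENCE; `α_i = δ_i − δ_0`, `u_i = α_i − α_i^*` (`u_0 = 0`); `3n + 1` variables with SOS indices
`σ_{i+1} ↦ 2i`, `κ_{i+1} ↦ 2i+1` (`i < n`), `ω_j ↦ 2n + j` (`j ≤ n`, speed deviations, rad/s).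
EXACT DATA `RecastData n` (model-4's files): `M, D, E, G, B` and the equilibrium as unit-circle points
`(s_i, c_i)`; the constant terms are the effective powers `Pprime i = P_{e,i}(δ^*)` so that `z = 0`
is an equilibrium EXACTLY (A1 eq=b; for a post-fault network this is the printed dispatch minus
`D_i ω∞′` in the frame of the declared equilibrium frequency — MODELLED row, see `WSCC9.lean`).

CONTENTS: `RecastData`, `Pprime`, `toModel : ClassicalSwing (n+1)` (the real model `M′`); the recast
as `SOS.Poly` DATA computed in Lean (`pσ pκ pω`, `psinδ pcosδ`, `pPe`, `fσ fκ fω`, `fk`, `polyField`,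
`hcon`, `hcons`); semantics `u`, `embed`, and the EXACT-EMBEDDING LEMMAS `eval_pPe`
(= `ClassicalSwing.Pe`), `eval_fω` (= the model's `ω̇_i`), `eval_fσ`, `eval_fκ`, `eval_hcon` (= 0) and
`hasDerivWithinAt_embed`: along every solution of `M′` every recast coordinate satisfies
`dz_k/dt = f_k(z)` — so `Σ_k ∂_kV·f_k` on `{h = 0}` IS `d(V∘embed)/dt`, the object a certificate bounds.
MODELLED as `ClassicalSwing.lean`; nothing here says a grid is stable. Instances: `WSCC9.lean`, ….
-/

noncomputable section

open Real Finset
open Literature.Computation.Certificates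
open Literature.Computation.Certificates.SOS
open Literature.Computation.Certificates.SOS.Poly

namespace Summit.Ventures.GridStability.Models

/-- Exact rational data of an `(n+1)`-machine classical model recast about a rational
equilibrium (PARTITION A1): inertia `M`, damping `D`, internal voltages `E`, reduced `G`, `B`,
and `(s_i, c_i) = (sin α_i^*, cos α_i^*)` for the equilibrium relative angles to machine `0`
(intended `s 0 = 0`, `c 0 = 1`, `s_i² + c_i² = 1`; supplied by model-4 via half-angle `t_i ∈ ℚ`). -/
structure RecastData (n : ℕ) where
  /-- `M_i = 2H_i/ω_s` -/
  M : Fin (n + 1) → ℚ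
  /-- damping `D_i` -/
  D : Fin (n + 1) → ℚ
  /-- internal voltage magnitudes `E_i` -/
  E : Fin (n + 1) → ℚ
  /-- reduced conductances `G_ij` -/
  G : Fin (n + 1) → Fin (n + 1) → ℚ
  /-- reduced susceptances `B_ij` -/
  B : Fin (n + 1) → Fin (n + 1) → ℚ
  /-- `sin α_i^*` -/
  s : Fin (n + 1) → ℚ
  /-- `cos α_i^*` -/
  c : Fin (n + 1) → ℚ

namespace RecastData

variable {n : ℕ} (d : RecastData n)

/-- `C_ij = E_iE_jB_ij` (Sauer–Pai (7.213)), exact. -/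
def Cc (i j : Fin (n + 1)) : ℚ := d.E i * d.E j * d.B i j

/-- `D_ij = E_iE_jG_ij` (Sauer–Pai (7.214)), exact. -/
def Dc (i j : Fin (n + 1)) : ℚ := d.E i * d.E j * d.G i j

/-- `sin(α_i^* − α_j^*) = s_i c_j − c_i s_j` (exact sine of the equilibrium angle difference). -/
def sd (i j : Fin (n + 1)) : ℚ := d.s i * d.c j - d.c i * d.s j

/-- `cos(α_i^* − α_j^*) = c_i c_j + s_i s_j`. -/
def cd (i j : Fin (n + 1)) : ℚ := d.c i * d.c j + d.s i * d.s j

/-- One coupling term of `P_{e,i}` at the equilibrium: `C_ij sin δ_ij^* + D_ij cos δ_ij^*`. -/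
def PeTermEq (i j : Fin (n + 1)) : ℚ := d.Cc i j * d.sd i j + d.Dc i j * d.cd i j

/-- REDEFINED mechanical power `P_i' := P_{e,i}(δ^*)` (A1 eq=b), exact, as a `List` sum
(kernel-friendly): `E_i²G_ii + Σ_{j ≠ i} (C_ij s_ij + D_ij c_ij)`. -/
def Pprime (i : Fin (n + 1)) : ℚ :=
  d.E i ^ 2 * d.G i i + (((List.finRange (n + 1)).filter (· ≠ i)).map (d.PeTermEq i)).sum

/-- `Pprime` as a `Finset` sum. -/
theorem Pprime_eq (i : Fin (n + 1)) :
    d.Pprime i = d.E i ^ 2 * d.G i i + ∑ j ∈ univ.erase i, d.PeTermEq i j := by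
  unfold Pprime; congr 1
  rw [← List.sum_toFinset _ ((List.nodup_finRange _).filter _)]
  congr 1; ext j; simp [Finset.mem_erase, ne_comm]

/-- The real model instance `M′` these data describe: `ClassicalSwing (n+1)` with the rational
data cast to `ℝ` and `P := Pprime` (so the rational equilibrium is exact). -/
def toModel : ClassicalSwing (n + 1) where
  M i := d.M i; D i := d.D i; P i := d.Pprime i; E i := d.E i; G i j := d.G i j; B i j := d.B i j

/-! ### The recast as `SOS.Poly` data -/

/-- `σ_i` as a polynomial: the variable `X (2(i−1))` for `i ≥ 1`, the zero polynomial for the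
reference machine `0`. -/
def pσ : Fin (n + 1) → Poly := Fin.cases [] fun i => X (2 * i.val)

/-- `κ_i`: `X (2(i−1)+1)` for `i ≥ 1`, zero for the reference. -/
def pκ : Fin (n + 1) → Poly := Fin.cases [] fun i => X (2 * i.val + 1)

/-- `ω_j`: `X (2n + j)`. -/
def pω (j : Fin (n + 1)) : Poly := X (2 * n + j.val)

/-- `cos u_i = 1 − κ_i`. -/
def pcos (i : Fin (n + 1)) : Poly := add (C 1) (neg (pκ i))

/-- `sin(u_i − u_j) = σ_i (1 − κ_j) − (1 − κ_i) σ_j`. -/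
def psinΔ (i j : Fin (n + 1)) : Poly :=
  add (mul (pσ i) (pcos j)) (neg (mul (pcos i) (pσ j)))

/-- `cos(u_i − u_j) = (1 − κ_i)(1 − κ_j) + σ_i σ_j`. -/
def pcosΔ (i j : Fin (n + 1)) : Poly := add (mul (pcos i) (pcos j)) (mul (pσ i) (pσ j))

/-- `sin δ_ij = sin(u_i − u_j) c_ij^* + cos(u_i − u_j) s_ij^*` (angle addition with the exact
equilibrium difference). -/
def psinδ (i j : Fin (n + 1)) : Poly :=
  add (smul (d.cd i j) (psinΔ i j)) (smul (d.sd i j) (pcosΔ i j))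

/-- `cos δ_ij = cos(u_i − u_j) c_ij^* − sin(u_i − u_j) s_ij^*`. -/
def pcosδ (i j : Fin (n + 1)) : Poly :=
  add (smul (d.cd i j) (pcosΔ i j)) (neg (smul (d.sd i j) (psinΔ i j)))

/-- The coupling term `C_ij sin δ_ij + D_ij cos δ_ij` of (7.212) as a polynomial. -/
def pPeTerm (i j : Fin (n + 1)) : Poly := add (smul (d.Cc i j) (d.psinδ i j)) (smul (d.Dc i j) (d.pcosδ i j))

/-- `P_{e,i}` (7.212) as a polynomial in `z`: `E_i²G_ii` followed by the coupling terms `j ≠ i`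
(list concatenation = polynomial addition). -/
def pPe (i : Fin (n + 1)) : Poly :=
  C (d.E i ^ 2 * d.G i i) ++ ((List.finRange (n + 1)).filter (· ≠ i)).flatMap (d.pPeTerm i)

/-- Recast `ω̇_i`-component: `(P_i' − P_{e,i}(z) − D_i ω_i)/M_i`, normalised (`Poly.norm`). -/
def fω (i : Fin (n + 1)) : Poly :=
  Poly.norm (smul (1 / d.M i) (add (add (C (d.Pprime i)) (neg (d.pPe i))) (neg (smul (d.D i) (pω i)))))

/-- Recast `σ̇_i`-component (`i ≥ 1`): `(1 − κ_i)(ω_i − ω_0)`, normalised. -/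
def fσ (i : Fin (n + 1)) : Poly := Poly.norm (mul (pcos i) (add (pω i) (neg (pω (0 : Fin (n + 1))))))

/-- Recast `κ̇_i`-component (`i ≥ 1`): `σ_i (ω_i − ω_0)`, normalised. -/
def fκ (i : Fin (n + 1)) : Poly := Poly.norm (mul (pσ i) (add (pω i) (neg (pω (0 : Fin (n + 1))))))

/-- The recast field as a function of the variable index: `f_{2i} = σ̇_{i+1}`,
`f_{2i+1} = κ̇_{i+1}` (`i < n`), `f_{2n+j} = ω̇_j` (`j ≤ n`), zero beyond `3n`. -/
def fk (k : ℕ) : Poly :=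
  if h : k < 2 * n then
    (if k % 2 = 0 then fσ (⟨k / 2 + 1, by omega⟩ : Fin (n + 1))
      else fκ (⟨k / 2 + 1, by omega⟩ : Fin (n + 1)))
  else if h' : k < 3 * n + 1 then d.fω ⟨k - 2 * n, by omega⟩ else []

/-- The recast vector field as the list `[f_0, …, f_{3n}]` (interface I2; component `k` = time
derivative of variable `k`; consumed verbatim by the toolchains and by the Bench theorems). -/
def polyField : List Poly := (List.range (3 * n + 1)).map d.fk

/-- Component access: `polyField[k] = fk k` (also beyond the end, where both are `[]`). -/
theorem polyField_getD (k : ℕ) : d.polyField.getD k [] = d.fk k := by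
  unfold polyField
  rw [List.getD_eq_getElem?_getD, List.getElem?_map]
  by_cases hk : k < 3 * n + 1
  · simp [List.getElem?_range hk]
  · have h2 : ¬ k < 2 * n := by omega
    simp [fk, hk, h2]

/-- The equality constraint of non-reference machine `i+1`: `σ² + κ² − 2κ`
(variables `2i`, `2i+1`), Kundu–Anghel §6.2 (constraint). -/
def hcon (i : Fin n) : Poly :=
  Poly.norm (add (add (mul (X (2 * i.val)) (X (2 * i.val))) (mul (X (2 * i.val + 1)) (X (2 * i.val + 1))))
    (smul (-2) (X (2 * i.val + 1))))

/-- The list of all `n` equality constraints (interface I2 `hs`). -/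
def hcons : List Poly := (List.finRange n).map hcon

/-! ### Semantics: the embedding and the exact-embedding lemmas -/

/-- Deviation of the relative angle of machine `i` from its equilibrium value:
`u_i = (δ_i − δ_0) − (δ_i^* − δ_0^*)` (`u_0 = 0`). -/
def u (δs : Fin (n + 1) → ℝ) (x : ClassicalSwing.State (n + 1)) (i : Fin (n + 1)) : ℝ :=
  (x.1 i - x.1 0) - (δs i - δs 0)

omit d in
/-- The reference machine has zero angle deviation: `u_0 = 0`. -/
@[simp] theorem u_zero (δs : Fin (n + 1) → ℝ) (x : ClassicalSwing.State (n + 1)) : u δs x 0 = 0 := by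
  simp [u]

/-- The embedding of the state `(δ, ω)` into the recast variables (an SOS point `ℕ → ℝ`):
index `2i ↦ sin u_{i+1}`, `2i+1 ↦ 1 − cos u_{i+1}` (`i < n`), `2n + j ↦ ω_j` (`j ≤ n`), else `0`. -/
def embed (δs : Fin (n + 1) → ℝ) (x : ClassicalSwing.State (n + 1)) (k : ℕ) : ℝ :=
  if h : k < 2 * n then
    (if k % 2 = 0 then sin (u δs x ⟨k / 2 + 1, by omega⟩)
      else 1 - cos (u δs x ⟨k / 2 + 1, by omega⟩))
  else if h' : k < 3 * n + 1 then x.2 ⟨k - 2 * n, by omega⟩ else 0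

variable (δs : Fin (n + 1) → ℝ) (x : ClassicalSwing.State (n + 1))

omit d in
/-- Embedding coordinate `2i` is `sin u_{i+1}`. -/
theorem embed_σ (i : Fin n) : embed δs x (2 * i.val) = sin (u δs x i.succ) := by
  have h : 2 * i.val < 2 * n := by omega
  simp [embed, h]
  rfl
omit d in
/-- Embedding coordinate `2i+1` is `1 − cos u_{i+1}`. -/
theorem embed_κ (i : Fin n) : embed δs x (2 * i.val + 1) = 1 - cos (u δs x i.succ) := by
  have h : 2 * i.val + 1 < 2 * n := by omega
  have h2 : (2 * i.val + 1) % 2 = 1 := by omega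
  have h3 : (2 * i.val + 1) / 2 = i.val := by omega
  simp [embed, h, h2, h3]
  rfl
omit d in
/-- Embedding coordinate `2n+j` is `ω_j`. -/
theorem embed_ω (j : Fin (n + 1)) : embed δs x (2 * n + j.val) = x.2 j := by
  have h : ¬ 2 * n + j.val < 2 * n := by omega
  have h' : 2 * n + j.val < 3 * n + 1 := by omega
  simp [embed, h, h']


omit d in
/-- Embedding at an even angle index. -/
theorem embed_even {k : ℕ} (hk : k < 2 * n) (hpar : k % 2 = 0) :
    embed δs x k = sin (u δs x ⟨k / 2 + 1, by omega⟩) := by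
  simp [embed, hk, hpar]
omit d in
/-- Embedding at an odd angle index. -/
theorem embed_odd {k : ℕ} (hk : k < 2 * n) (hpar : ¬ k % 2 = 0) :
    embed δs x k = 1 - cos (u δs x ⟨k / 2 + 1, by omega⟩) := by
  simp [embed, hk, hpar]
omit d in
/-- Embedding at a speed index. -/
theorem embed_mid {k : ℕ} (hk : ¬ k < 2 * n) (hk' : k < 3 * n + 1) :
    embed δs x k = x.2 ⟨k - 2 * n, by omega⟩ := by
  simp [embed, hk, hk']
omit d in
/-- Embedding beyond the last variable is `0`. -/
theorem embed_high {k : ℕ} (hk' : ¬ k < 3 * n + 1) : embed δs x k = 0 := by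
  have hk : ¬ k < 2 * n := by omega
  simp [embed, hk, hk']

/-- `fk` at an even angle index is `fσ`. -/
theorem fk_even {k : ℕ} (hk : k < 2 * n) (hpar : k % 2 = 0) :
    d.fk k = fσ (⟨k / 2 + 1, by omega⟩ : Fin (n + 1)) := by
  simp [fk, hk, hpar]
/-- `fk` at an odd angle index is `fκ`. -/
theorem fk_odd {k : ℕ} (hk : k < 2 * n) (hpar : ¬ k % 2 = 0) :
    d.fk k = fκ (⟨k / 2 + 1, by omega⟩ : Fin (n + 1)) := by
  simp [fk, hk, hpar]
/-- `fk` at a speed index is `fω`. -/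
theorem fk_mid {k : ℕ} (hk : ¬ k < 2 * n) (hk' : k < 3 * n + 1) :
    d.fk k = d.fω ⟨k - 2 * n, by omega⟩ := by
  simp [fk, hk, hk']
/-- `fk` beyond the last variable is `[]`. -/
theorem fk_high {k : ℕ} (hk' : ¬ k < 3 * n + 1) : d.fk k = [] := by
  have hk : ¬ k < 2 * n := by omega
  simp [fk, hk, hk']

/-- `pσ i` evaluates to `sin u_i` on the embedding (also for the reference, `0 = sin 0`). -/
theorem eval_pσ (i : Fin (n + 1)) : (pσ i).eval (embed δs x) = sin (u δs x i) := by
  cases i using Fin.cases with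
  | zero => simp [pσ]
  | succ i => simp [pσ, embed_σ]
/-- `pκ i` evaluates to `1 − cos u_i`. -/
theorem eval_pκ (i : Fin (n + 1)) : (pκ i).eval (embed δs x) = 1 - cos (u δs x i) := by
  cases i using Fin.cases with
  | zero => simp [pκ]
  | succ i => simp [pκ, embed_κ]
/-- `pω j` evaluates to `ω_j`. -/
theorem eval_pω (j : Fin (n + 1)) : (pω j).eval (embed δs x) = x.2 j := by
  simp [pω, embed_ω]
/-- `pcos i` evaluates to `cos u_i`. -/
theorem eval_pcos (i : Fin (n + 1)) : (pcos i).eval (embed δs x) = cos (u δs x i) := by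
  simp [pcos, eval_neg, eval_pκ]

/-- `psinΔ i j` evaluates to `sin(u_i − u_j)`. -/
theorem eval_psinΔ (i j : Fin (n + 1)) :
    (psinΔ i j).eval (embed δs x) = sin (u δs x i - u δs x j) := by
  simp [psinΔ, eval_neg, eval_pσ, eval_pcos, sin_sub]; ring
/-- `pcosΔ i j` evaluates to `cos(u_i − u_j)`. -/
theorem eval_pcosΔ (i j : Fin (n + 1)) :
    (pcosΔ i j).eval (embed δs x) = cos (u δs x i - u δs x j) := by
  simp [pcosΔ, eval_pσ, eval_pcos, cos_sub]

/-- A1 faithfulness hypotheses: the rational circle points ARE the sines/cosines of the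
equilibrium relative angles. -/
structure EqData (δs : Fin (n + 1) → ℝ) : Prop where
  hs : ∀ i, (d.s i : ℝ) = sin (δs i - δs 0)
  hc : ∀ i, (d.c i : ℝ) = cos (δs i - δs 0)

variable {δs}

/-- Under `EqData`, `sd i j = sin(δ_i^* − δ_j^*)`. -/
theorem sd_cast (h : d.EqData δs) (i j : Fin (n + 1)) : (d.sd i j : ℝ) = sin (δs i - δs j) := by
  have e : δs i - δs j = (δs i - δs 0) - (δs j - δs 0) := by ring
  simp only [sd, Rat.cast_sub, Rat.cast_mul, h.hs, h.hc, e, sin_sub]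
/-- Under `EqData`, `cd i j = cos(δ_i^* − δ_j^*)`. -/
theorem cd_cast (h : d.EqData δs) (i j : Fin (n + 1)) : (d.cd i j : ℝ) = cos (δs i - δs j) := by
  have e : δs i - δs j = (δs i - δs 0) - (δs j - δs 0) := by ring
  simp only [cd, Rat.cast_add, Rat.cast_mul, h.hs, h.hc, e, cos_sub]

omit d in
/-- `δ_i − δ_j = (u_i − u_j) + (δ_i^* − δ_j^*)`. -/
theorem angle_split (i j : Fin (n + 1)) :
    x.1 i - x.1 j = (u δs x i - u δs x j) + (δs i - δs j) := by
  simp only [u]; ring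

/-- Faithful sine: `psinδ i j` evaluates to `sin(δ_i − δ_j)`. -/
theorem eval_psinδ (h : d.EqData δs) (i j : Fin (n + 1)) :
    (d.psinδ i j).eval (embed δs x) = sin (x.1 i - x.1 j) := by
  rw [angle_split (δs := δs) x i j, sin_add]
  simp [psinδ, eval_smul, eval_psinΔ, eval_pcosΔ, d.sd_cast h, d.cd_cast h]; ring

/-- Faithful cosine: `pcosδ i j` evaluates to `cos(δ_i − δ_j)`. -/
theorem eval_pcosδ (h : d.EqData δs) (i j : Fin (n + 1)) :
    (d.pcosδ i j).eval (embed δs x) = cos (x.1 i - x.1 j) := by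
  rw [angle_split (δs := δs) x i j, cos_add]
  simp [pcosδ, eval_smul, eval_neg, eval_psinΔ, eval_pcosΔ, d.sd_cast h, d.cd_cast h]; ring

/-- The coupling polynomial evaluates to `C_ij sin δ_ij + D_ij cos δ_ij`. -/
theorem eval_pPeTerm (h : d.EqData δs) (i j : Fin (n + 1)) :
    (d.pPeTerm i j).eval (embed δs x) =
      d.toModel.Ccoef i j * sin (x.1 i - x.1 j) + d.toModel.Dcoef i j * cos (x.1 i - x.1 j) := by
  simp [pPeTerm, eval_smul, d.eval_psinδ x h, d.eval_pcosδ x h, ClassicalSwing.Ccoef,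
    ClassicalSwing.Dcoef, toModel, Cc, Dc]

/-- **Faithful electrical power**: `pPe i` evaluates on the embedding to `ClassicalSwing.Pe` of
the model `M′` (Sauer–Pai (7.212)). -/
theorem eval_pPe (h : d.EqData δs) (i : Fin (n + 1)) :
    (d.pPe i).eval (embed δs x) = d.toModel.Pe x.1 i := by
  unfold pPe ClassicalSwing.Pe
  rw [eval_append, eval_flatMap, eval_C]
  have hset : ((List.finRange (n + 1)).filter (· ≠ i)).toFinset = univ.erase i := by
    ext j; simp [Finset.mem_erase, ne_comm]
  rw [← List.sum_toFinset _ ((List.nodup_finRange _).filter _), hset]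
  simp [d.eval_pPeTerm x h, toModel]

/-- **Faithful `ω̇`**: the recast component `fω i` evaluates on the embedding to the `ω̇_i` of the
model `M′` (`ClassicalSwing.field`), for `M_i ≠ 0`. -/
theorem eval_fω (h : d.EqData δs) (i : Fin (n + 1)) (hM : d.M i ≠ 0) :
    (d.fω i).eval (embed δs x) = (d.toModel.field x).2 i := by
  have hM' : (d.M i : ℝ) ≠ 0 := by exact_mod_cast hM
  simp [fω, eval_smul, eval_neg, d.eval_pPe x h, eval_pω, ClassicalSwing.field, toModel]
  field_simp
  ring

/-- `fσ i` evaluates to `cos u_i · (ω_i − ω_0)` = `d(sin u_i)/dt` along the model. -/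
theorem eval_fσ (i : Fin (n + 1)) :
    (fσ i).eval (embed δs x) = cos (u δs x i) * (x.2 i - x.2 0) := by
  simp only [fσ, eval_norm, eval_mul, eval_add, eval_neg, eval_pcos, eval_pω]; ring

/-- `fκ i` evaluates to `sin u_i · (ω_i − ω_0)` = `d(1 − cos u_i)/dt` along the model. -/
theorem eval_fκ (i : Fin (n + 1)) :
    (fκ i).eval (embed δs x) = sin (u δs x i) * (x.2 i - x.2 0) := by
  simp only [fκ, eval_norm, eval_mul, eval_add, eval_neg, eval_pσ, eval_pω]; ring

/-- **The constraints hold identically** on the image of the embedding. -/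
theorem eval_hcon (i : Fin n) : (hcon i).eval (embed δs x) = 0 := by
  simp [hcon, eval_smul, embed_σ, embed_κ]
  nlinarith [sin_sq_add_cos_sq (u δs x i.succ)]

/-- **Exact embedding lemma (chain rule).** Along every solution `c` of the model `M′` on the
time set `s` (all `M_i ≠ 0`, A1 hypotheses `h`), EVERY recast coordinate satisfies
`d/dt z_k(t) = f_k(z(t))` within `s`: the recast field is the push-forward of the swing field.
Consequently, for a polynomial `V`, `Σ_k ∂_kV(z) f_k(z)` restricted to `{h = 0}` is the time
derivative of `V ∘ embed` along true trajectories — the object an SOS certificate bounds. -/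
theorem hasDerivWithinAt_embed (h : d.EqData δs) (hM : ∀ i, d.M i ≠ 0) {c : ℝ → ClassicalSwing.State (n + 1)}
    {s : Set ℝ} (hc : d.toModel.IsSolutionOn c s) {t : ℝ} (ht : t ∈ s) (k : ℕ) :
    HasDerivWithinAt (fun τ => embed δs (c τ) k) ((d.polyField.getD k []).eval (embed δs (c t))) s t := by
  rw [polyField_getD]
  have hsol := hc t ht
  have h1 : ∀ j, HasDerivWithinAt (fun τ => (c τ).1 j) ((c t).2 j) s t := fun j => by
    have := hasDerivWithinAt_pi.1 hsol.hasFDerivWithinAt.fst.hasDerivWithinAt j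
    simpa [ClassicalSwing.field] using this
  have h2 : ∀ j, HasDerivWithinAt (fun τ => (c τ).2 j) ((d.toModel.field (c t)).2 j) s t := fun j => by
    have := hasDerivWithinAt_pi.1 hsol.hasFDerivWithinAt.snd.hasDerivWithinAt j
    simpa using this
  have hu : ∀ j, HasDerivWithinAt (fun τ => u δs (c τ) j) ((c t).2 j - (c t).2 0) s t := fun j => by
    simpa [u] using ((h1 j).sub (h1 0)).sub_const (δs j - δs 0)
  by_cases hk : k < 2 * n
  · by_cases hpar : k % 2 = 0
    · simp only [d.fk_even hk hpar, embed_even _ _ hk hpar, eval_fσ]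
      simpa [mul_comm] using (hu ⟨k / 2 + 1, by omega⟩).sin
    · simp only [d.fk_odd hk hpar, embed_odd _ _ hk hpar, eval_fκ]
      simpa [mul_comm] using ((hu ⟨k / 2 + 1, by omega⟩).cos).const_sub 1
  · by_cases hk' : k < 3 * n + 1
    · simp only [d.fk_mid hk hk', embed_mid _ _ hk hk', d.eval_fω _ h _ (hM _)]
      exact h2 _
    · simp only [d.fk_high hk', embed_high _ _ hk', eval_nil]
      exact hasDerivWithinAt_const _ _ _

end RecastData

end Summit.Ventures.GridStability.Models
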